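/-
Copyright (c) 2026 the pub-hodgecm-mathlib formalisation cell (harness21).  Prover seat hodgecm-mathlib-LH4-p13 (g8), req620 Track A «(D-RAM) FOUR-FRAME» squad, tier 0,
STAGE-1b (dealer LH4-plan (g13) WORD #66 (3): first refusal on the (L-lab) statements of LH4-p05 (g8)'s (β) chain; p05 11:43:12Z «(L-lab-A″) CLEAN ⇒ LABELLED BY SOME
CLASS»): brick (L-lab-16) «THE CLEAN SHELL IS ONE-CLASS, GIVEN AN S-DIAGONAL GENERATING TRIPLE» — the shape-free reduction of (A″) to the label-free lattice statement (GS),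
in the unimodular diagonal model of ★ p859223.  2026-09-04.
-/
import Summits.HodgeConjecture.HodgeConjecture.Theorems.F0P3cDyRamModelSquareLevelClean   -- ★ p859653 (this seat, (L-lab-14)): `pairing_diagonal_three`, `smul_diagonal_mulVec_apply`; brings ★ p859483,
                                                                                          -- ★ p859272 `exists_skew_near_of_trace_deep`, ★ (L-lab-3) `valueSetMod_smul_xPlus`, ★ Literature
                                                                                          -- `map_refSkewScalar_eq_neg`, `v_refSkewScalar`, `refSkewScalar_ne_zero`, ★ p859056, ★ `mem_mapGL_iff`
import HarnessLib

/-!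
# Crux `H413`, line LH4 «(D-RAM) FOUR-FRAME», STAGE-1b — (L-lab-16) «THE CLEAN SHELL IS ONE-CLASS, GIVEN AN S-DIAGONAL GENERATING TRIPLE» ((A″) ⇐ (GS))

Cell `hodgecm-mathlib` (D-0151), FLOOR 0, crux item H413 = `stmt-HodgeConjecture-24833`, route of record `HCCMUnconditional`; squad F0∕P3c∕LH4.  THEOREMS ONLY (no `def`, no
instance, no notation, no `sorry`, default heartbeats), ★-only imports, lane `--supports stmt-HodgeConjecture-24833`.

THE MATHEMATICS (model: form `h = diag(c)`, `c₀, c₁` `σ`-fixed; `T = diag(α, β, 1)`, `α, β ∈ E¹`; `X = T − 1 = diag(u, w, 0)`; `M` a `T`-stable lattice on which `h` is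
integral; write `S(y, y′) = h(y, Xy′) = c₀σ(y₀)(uy′₀) + c₁σ(y₁)(wy′₁)`, so that the model label value of `y` is `S(y, y)`).
* §1 `cross_add_map_cross_eq` — the EXACT skew relation `S(y′, y) + σS(y, y′) = h(y′, T⁻¹X²y)` (from `σu = −u∕α`); hence on the CLEAN shell (`X²·M ⊆ ϖ^{m_c}M`)
  `|S(y′, y) + σS(y, y′)| ≤ |ϖ^{m_c}|` (`v_cross_add_map_cross_le`): `S` is skew-hermitian modulo `ϖ^{m_c}`, and in particular `Tr S(y, y) ∈ ϖ^{m_c}`.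
* §1 `cross_self_expand` — for `y = a·y₁ + b·y₂ + c′·y₃` with `Xy₃ = 0`: `S(y, y) = N(a)S(y₁,y₁) + σa·b·S(y₁,y₂) + σb·a·S(y₂,y₁) + N(b)S(y₂,y₂)`.
* §2 HEAD **`exists_class_setOf_modelValue_eq_of_triple`** — (A″) ⇐ (GS): if `y₁, y₂, y₃` generate `M` over `𝒪` (every `y ∈ M` is `a y₁ + b y₂ + c′ y₃`, `a, b ∈ 𝒪`), `Xy₃ = 0`,
  `S(y₁, y₂) = 0`, `|S(y₁, y₁)| = |ϖ|^{d % 2}` and `|S(y₂, y₂)| ≤ |ϖ^m|`, with `d % 2 < m` and `m + d ≤ m_c + 1`, then the thickened model value set at precision `m` EQUALS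
  `valueSetMod σ ϖ m (e • X₊)` for a `σ`-fixed UNIT `e` — namely `e = z′∕t₊` where `z′` is the skew element `ϖ^m`-close to `S(y₁, y₁)` (★ p859272, the design identity
  `m_c = 2⌊(m* + d)∕2⌋`): every value is `≡ N(a)·S(y₁,y₁) (mod ϖ^m)`.
(GS) is a LABEL-FREE statement about the clean-shell vertex; in the ★ HNF letters the triple is `(v⁰, v¹ − (S(v⁰,v¹)∕S(v⁰,v⁰))v⁰, v²)` with `|S(y₂,y₂)| = |ϖ|^{n₁+n₂−a₂−ℓ₀}`
(LH4-p13 (g8) bus 12:01Z (c)); its per-stratum discharge is the remaining input of (A″).  Numerics (F0P3a-p01 g29∕tw3 engine, driver `…/LH4-p13/g8/ashell.LH4p13g8.py`): every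
clean-shell vertex is one-class at R-U keys (4,4,6) (6,4,4) (8,4,4) (8,6,6) (10,6,6) and R-P keys (9,7,7) (11,9,9).

HONEST LABEL: count-neutral; (A″) is proved here CONDITIONALLY on (GS); (β) and the T₊ row OPEN.  HC_CM remains proved only modulo the printed citations (2 remaining named
inputs: hLiu418 = `stmt-HodgeConjecture-24832`, h413 = `stmt-HodgeConjecture-24833`) until rung 0 closes.
-/

noncomputable section

namespace Summit.HodgeConjecture.HodgeConjecture.Cruxes.H413.F0P3cDyRamCleanShellOneClass

open Literature.NumberTheory.Automorphic Literature.NumberTheory.Automorphic.HermitianLattice Literature.NumberTheory.Automorphic.UnitaryGroup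
open Literature.NumberTheory.Automorphic.UnitaryLatticeTree Literature.NumberTheory.Automorphic.UnitaryThreeFourFrame
open Literature.NumberTheory.LocalFields Literature.NumberTheory.LocalFields.WildQuadraticDatum
open Summit.HodgeConjecture.HodgeConjecture.Cruxes.H413.F0P3cDyRamFourFramePieces
open Summit.HodgeConjecture.HodgeConjecture.Cruxes.H413.F0P3cDyRamFourFrameCensusDefs
open Summit.HodgeConjecture.HodgeConjecture.Cruxes.H413.F0P3cDyRamSmulXPlusLabel (valueSetMod_smul_xPlus)
open Summit.HodgeConjecture.HodgeConjecture.Cruxes.H413.F0P3cDyRamValueSetSkewLineCriterion (exists_skew_near_of_trace_deep)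
open Summit.HodgeConjecture.HodgeConjecture.Cruxes.H413.F0P3cDyRamLevelTokenHNF (latticeInLevel_iff_forall_smul_mulVec_mem)
open Summit.HodgeConjecture.HodgeConjecture.Cruxes.H413.F0P3cDyRamUniformizerPowerTube (v_pow_eq_exp_neg)
open Summit.HodgeConjecture.HodgeConjecture.Cruxes.H413.F0P3cDyRamModelSquareLevelClean (pairing_diagonal_three smul_diagonal_mulVec_apply)
open scoped Valued WithZero Matrix MatrixGroups
open WithZero

variable {K : Type} [Field K] [Valued K ℤᵐ⁰]

/-! ## §1  The skew relation of `S(y, y′) = h(y, Xy′)` and the expansion of `S(y, y)` on a generating triple -/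

omit [Valued K ℤᵐ⁰] in
/-- **THE EXACT SKEW RELATION.**  `S(y′, y) + σS(y, y′) = c₀σ(y′₀)·α⁻¹(α−1)²y₀ + c₁σ(y′₁)·β⁻¹(β−1)²y₁ = h(y′, T⁻¹X²y)` for `α, β ∈ E¹` (`σ(α − 1) = −(α − 1)∕α`), `c₀, c₁` `σ`-fixed,
`σ` an involution. [cite: Kottwitz1986BaseChangeUnits, §1 pp. 240–241] [cite: Jacobowitz1962, §4] -/
theorem cross_add_map_cross_eq {σ : K →+* K} (hσ : ∀ x, σ (σ x) = x) {c : Fin 3 → K} (hc₀ : σ (c 0) = c 0) (hc₁ : σ (c 1) = c 1) {α β : K}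
    (hα : α * σ α = 1) (hβ : β * σ β = 1) (y y' : Fin 3 → K) :
    (c 0 * σ (y' 0) * ((α - 1) * y 0) + c 1 * σ (y' 1) * ((β - 1) * y 1)) + σ (c 0 * σ (y 0) * ((α - 1) * y' 0) + c 1 * σ (y 1) * ((β - 1) * y' 1)) =
      c 0 * σ (y' 0) * (α⁻¹ * ((α - 1) * (α - 1) * y 0)) + c 1 * σ (y' 1) * (β⁻¹ * ((β - 1) * (β - 1) * y 1)) := by
  have hα0 : α ≠ 0 := fun h => by rw [h, zero_mul] at hα; exact zero_ne_one hα
  have hβ0 : β ≠ 0 := fun h => by rw [h, zero_mul] at hβ; exact zero_ne_one hβ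
  have hσα : σ α = α⁻¹ := eq_inv_of_mul_eq_one_right hα
  have hσβ : σ β = β⁻¹ := eq_inv_of_mul_eq_one_right hβ
  simp only [map_add, map_mul, map_sub, map_one, hσ, hc₀, hc₁, hσα, hσβ]
  field_simp
  ring

/-- **SKEW-HERMITIAN MODULO `ϖ^{m_c}` ON THE CLEAN SHELL.**  If `h = diag(c)` is integral on `M × M`, `M` is stable under `T = diag(α, β, 1)` and
`diag((α−1)², (β−1)², 0)·M ⊆ ϖ^{m_c}·M`, then `|S(y′, y) + σS(y, y′)| ≤ |ϖ^{m_c}|` for `y, y′ ∈ M` (the right-hand side of the skew relation is `ϖ^{m_c}·h(y′, T⁻¹z)` with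
`z = ϖ^{−m_c}X²y ∈ M`). [cite: Kottwitz1986BaseChangeUnits, §1 pp. 240–241] [cite: Jacobowitz1962, §4] -/
theorem v_cross_add_map_cross_le {σ : K →+* K} (hσ : ∀ x, σ (σ x) = x) {ϖ : K} (hϖ0 : ϖ ≠ 0) {c : Fin 3 → K} (hc₀ : σ (c 0) = c 0) (hc₁ : σ (c 1) = c 1)
    {α β : K} (hα : α * σ α = 1) (hβ : β * σ β = 1) {M : Submodule 𝒪[K] (Fin 3 → K)}
    (hint : ∀ y ∈ M, ∀ y' ∈ M, Valued.v (pairing σ (Matrix.diagonal c) y y') ≤ 1)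
    {T : GL (Fin 3) K} (hT : (T : Matrix (Fin 3) (Fin 3) K) = Matrix.diagonal ![α, β, 1]) (hTM : mapGL T M = M) {mc : ℕ}
    (hsq : LatticeInLevel ϖ mc (Matrix.diagonal ![(α - 1) * (α - 1), (β - 1) * (β - 1), 0]) M) {y y' : Fin 3 → K} (hy : y ∈ M) (hy' : y' ∈ M) :
    Valued.v ((c 0 * σ (y' 0) * ((α - 1) * y 0) + c 1 * σ (y' 1) * ((β - 1) * y 1)) + σ (c 0 * σ (y 0) * ((α - 1) * y' 0) + c 1 * σ (y 1) * ((β - 1) * y' 1))) ≤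
      Valued.v (ϖ ^ mc) := by
  have hϖm : (ϖ ^ mc : K) ≠ 0 := pow_ne_zero _ hϖ0
  have hα0 : α ≠ 0 := fun h => by rw [h, zero_mul] at hα; exact zero_ne_one hα
  have hβ0 : β ≠ 0 := fun h => by rw [h, zero_mul] at hβ; exact zero_ne_one hβ
  -- `z = ϖ^{−m_c}X²y ∈ M` and `T⁻¹z ∈ M`
  have hz := (latticeInLevel_iff_forall_smul_mulVec_mem hϖ0 mc _ M).1 hsq y hy
  have hTinv : ((T⁻¹ : GL (Fin 3) K) : Matrix (Fin 3) (Fin 3) K) = Matrix.diagonal ![α⁻¹, β⁻¹, 1] := by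
    rw [Matrix.coe_units_inv, hT]
    refine Matrix.inv_eq_left_inv ?_
    rw [Matrix.diagonal_mul_diagonal, ← Matrix.diagonal_one]
    congr 1
    funext i
    fin_cases i <;> simp [hα0, hβ0]
  have hTz : ((T⁻¹ : GL (Fin 3) K) : Matrix (Fin 3) (Fin 3) K) *ᵥ (((ϖ ^ mc)⁻¹ • Matrix.diagonal ![(α - 1) * (α - 1), (β - 1) * (β - 1), 0]) *ᵥ y) ∈ M :=
    (mem_mapGL_iff T M _).1 (hTM.symm ▸ hz)
  have hp := hint y' hy' _ hTz
  rw [pairing_diagonal_three] at hp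
  simp only [hTinv, Matrix.mulVec_diagonal, smul_diagonal_mulVec_apply, Matrix.cons_val_zero, Matrix.cons_val_one, Matrix.cons_val_two,
    Matrix.tail_cons, Matrix.head_cons, zero_mul, mul_zero, add_zero] at hp
  -- `hp : |σ(y′₀)c₀·α⁻¹(ϖ^{−m_c}((α−1)²y₀)) + σ(y′₁)c₁·β⁻¹(ϖ^{−m_c}((β−1)²y₁))| ≤ 1`
  rw [cross_add_map_cross_eq hσ hc₀ hc₁ hα hβ]
  have key : c 0 * σ (y' 0) * (α⁻¹ * ((α - 1) * (α - 1) * y 0)) + c 1 * σ (y' 1) * (β⁻¹ * ((β - 1) * (β - 1) * y 1)) =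
      ϖ ^ mc * (σ (y' 0) * c 0 * (α⁻¹ * ((ϖ ^ mc)⁻¹ * ((α - 1) * (α - 1) * y 0))) + σ (y' 1) * c 1 * (β⁻¹ * ((ϖ ^ mc)⁻¹ * ((β - 1) * (β - 1) * y 1)))) := by
    field_simp
  rw [key, map_mul]
  calc Valued.v (ϖ ^ mc) * Valued.v (σ (y' 0) * c 0 * (α⁻¹ * ((ϖ ^ mc)⁻¹ * ((α - 1) * (α - 1) * y 0))) +
          σ (y' 1) * c 1 * (β⁻¹ * ((ϖ ^ mc)⁻¹ * ((β - 1) * (β - 1) * y 1))))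
      ≤ Valued.v (ϖ ^ mc) * 1 := mul_le_mul_right hp _
    _ = Valued.v (ϖ ^ mc) := mul_one _

omit [Valued K ℤᵐ⁰] in
/-- **EXPANSION ON A TRIPLE.**  If `y = a·y₁ + b·y₂ + c′·y₃` coordinatewise and `y₃` lies on the eigenvalue-`1` axis (`y₃ ₀ = y₃ ₁ = 0`, i.e. `Xy₃ = 0`), then
`S(y, y) = N(a)S(y₁,y₁) + σa·b·S(y₁,y₂) + σb·a·S(y₂,y₁) + N(b)S(y₂,y₂)`. [cite: Jacobowitz1962, §4] -/
theorem cross_self_expand (σ : K →+* K) (c : Fin 3 → K) (α β : K) {y y₁ y₂ y₃ : Fin 3 → K} {a b c' : K}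
    (hy : ∀ i, y i = a * y₁ i + b * y₂ i + c' * y₃ i) (hy₃0 : y₃ 0 = 0) (hy₃1 : y₃ 1 = 0) :
    c 0 * σ (y 0) * ((α - 1) * y 0) + c 1 * σ (y 1) * ((β - 1) * y 1) =
      a * σ a * (c 0 * σ (y₁ 0) * ((α - 1) * y₁ 0) + c 1 * σ (y₁ 1) * ((β - 1) * y₁ 1)) +
        σ a * b * (c 0 * σ (y₁ 0) * ((α - 1) * y₂ 0) + c 1 * σ (y₁ 1) * ((β - 1) * y₂ 1)) +
        σ b * a * (c 0 * σ (y₂ 0) * ((α - 1) * y₁ 0) + c 1 * σ (y₂ 1) * ((β - 1) * y₁ 1)) +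
        b * σ b * (c 0 * σ (y₂ 0) * ((α - 1) * y₂ 0) + c 1 * σ (y₂ 1) * ((β - 1) * y₂ 1)) := by
  rw [hy 0, hy 1, hy₃0, hy₃1]
  simp only [map_add, map_mul, mul_zero, add_zero]
  ring

omit [Valued K ℤᵐ⁰] in
/-- The model label value is the diagonal of `S`: `c₀(α−1)N(y₀) + c₁(β−1)N(y₁) = S(y, y)`. [cite: Rogawski1990, §4.9 Prop. 4.9.1 (b) p. 55] -/
theorem modelValue_eq_cross_self (σ : K →+* K) (c : Fin 3 → K) (α β : K) (y : Fin 3 → K) :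
    c 0 * (α - 1) * (y 0 * σ (y 0)) + c 1 * (β - 1) * (y 1 * σ (y 1)) = c 0 * σ (y 0) * ((α - 1) * y 0) + c 1 * σ (y 1) * ((β - 1) * y 1) := by
  ring

/-! ## §2  HEAD — the clean shell is one-class, given an S-diagonal generating triple ((A″) ⇐ (GS)) -/

/-- **(A″) ⇐ (GS): THE MODEL VALUE SET IS A SINGLE CLASS.**  Ramified datum clauses (`σ` a valuation-preserving involution with even valuations on its fixed points,
`|ϖ| = exp(−1)`, `|ϖ − σϖ| = |ϖ|^d`, `d ≥ 1`, `|2| = |ϖ|^t`), `c₀, c₁` `σ`-fixed, `α, β ∈ E¹`; `M` a lattice on which `diag(c)` is integral, stable under `T = diag(α, β, 1)`,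
CLEAN (`diag((α−1)², (β−1)², 0)·M ⊆ ϖ^{m_c}M`), precisions `d % 2 < m`, `m + d ≤ m_c + 1`.  Suppose (GS): `y₁, y₂ ∈ M` and `y₃` with `y₃ ₀ = y₃ ₁ = 0` generate `M`
(`y = a y₁ + b y₂ + c′ y₃`, `a, b ∈ 𝒪`), `S(y₁, y₂) = 0`, `|S(y₁, y₁)| = |ϖ|^{d % 2}`, `|S(y₂, y₂)| ≤ |ϖ^m|`.  Then for some `σ`-fixed unit `e`:
`{v | ∃ y ∈ M, |ϖ^{−m}(v − (c₀(α−1)N(y₀) + c₁(β−1)N(y₁)))| ≤ 1} = valueSetMod σ ϖ m (e • X₊)` — the vertex is LABELLED by the class of `e`.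
Proof: `S(y,y) ≡ N(a)S(y₁,y₁) + N(b)S(y₂,y₂) ≡ N(a)S(y₁,y₁) (mod ϖ^m)` by §1 (the cross term `S(y₂,y₁) ≡ −σS(y₁,y₂) = 0`), and `S(y₁,y₁) ≡ e·t₊ (mod ϖ^m)` by its deep trace
(★ p859272). [cite: Rogawski1990, §4.9 Prop. 4.9.1 (b) p. 55] [cite: Serre1979, Ch. III §3 Prop. 7] [cite: Kottwitz1986BaseChangeUnits, §1 pp. 240–241] -/
theorem exists_class_setOf_modelValue_eq_of_triple {σ : K →+* K} {ϖ : K} {d t : ℕ} (hσ : ∀ x, σ (σ x) = x) (hvσ : ∀ a, Valued.v (σ a) = Valued.v a)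
    (hfix : ∀ x : K, σ x = x → x ≠ 0 → ∃ n : ℤ, Valued.v x = exp (2 * n))
    (hϖ : Valued.v ϖ = exp (-1 : ℤ)) (hd : Valued.v (ϖ - σ ϖ) = Valued.v ϖ ^ d) (ht : Valued.v (2 : K) = Valued.v ϖ ^ t)
    {c : Fin 3 → K} (hc₀ : σ (c 0) = c 0) (hc₁ : σ (c 1) = c 1) {α β : K} (hα : α * σ α = 1) (hβ : β * σ β = 1)
    {M : Submodule 𝒪[K] (Fin 3 → K)} (hint : ∀ y ∈ M, ∀ y' ∈ M, Valued.v (pairing σ (Matrix.diagonal c) y y') ≤ 1)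
    {T : GL (Fin 3) K} (hT : (T : Matrix (Fin 3) (Fin 3) K) = Matrix.diagonal ![α, β, 1]) (hTM : mapGL T M = M)
    {m mc : ℕ} (h1d : 1 ≤ d) (hm : d % 2 < m) (hmc : m + d ≤ mc + 1)
    (hsq : LatticeInLevel ϖ mc (Matrix.diagonal ![(α - 1) * (α - 1), (β - 1) * (β - 1), 0]) M)
    {y₁ y₂ y₃ : Fin 3 → K} (hy₁ : y₁ ∈ M) (hy₂ : y₂ ∈ M) (hy₃0 : y₃ 0 = 0) (hy₃1 : y₃ 1 = 0)
    (hgen : ∀ y ∈ M, ∃ a b c' : K, Valued.v a ≤ 1 ∧ Valued.v b ≤ 1 ∧ ∀ i, y i = a * y₁ i + b * y₂ i + c' * y₃ i)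
    (h12 : c 0 * σ (y₁ 0) * ((α - 1) * y₂ 0) + c 1 * σ (y₁ 1) * ((β - 1) * y₂ 1) = 0)
    (hs₁ : Valued.v (c 0 * σ (y₁ 0) * ((α - 1) * y₁ 0) + c 1 * σ (y₁ 1) * ((β - 1) * y₁ 1)) = Valued.v ϖ ^ (d % 2))
    (hs₂ : Valued.v (c 0 * σ (y₂ 0) * ((α - 1) * y₂ 0) + c 1 * σ (y₂ 1) * ((β - 1) * y₂ 1)) ≤ Valued.v (ϖ ^ m)) :
    ∃ e : K, σ e = e ∧ Valued.v e = 1 ∧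
      {v | ∃ y ∈ M, Valued.v ((ϖ ^ m)⁻¹ * (v - (c 0 * (α - 1) * (y 0 * σ (y 0)) + c 1 * (β - 1) * (y 1 * σ (y 1))))) ≤ 1} =
        valueSetMod σ ϖ m (e • xPlus σ ϖ d) := by
  have hϖ0 : ϖ ≠ 0 := (Valuation.ne_zero_iff Valued.v).1 (by rw [hϖ]; exact exp_ne_zero)
  have hϖm : (ϖ ^ m : K) ≠ 0 := pow_ne_zero _ hϖ0
  -- names for the four `S`-values of the triple
  set s₁ : K := c 0 * σ (y₁ 0) * ((α - 1) * y₁ 0) + c 1 * σ (y₁ 1) * ((β - 1) * y₁ 1) with hs₁def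
  set s₂ : K := c 0 * σ (y₂ 0) * ((α - 1) * y₂ 0) + c 1 * σ (y₂ 1) * ((β - 1) * y₂ 1) with hs₂def
  set s₂₁ : K := c 0 * σ (y₂ 0) * ((α - 1) * y₁ 0) + c 1 * σ (y₂ 1) * ((β - 1) * y₁ 1) with hs₂₁def
  -- the trace of `s₁` and the cross value `s₂₁` are deep (clean shell, §1)
  have htr : Valued.v (s₁ + σ s₁) ≤ Valued.v (ϖ ^ mc) := v_cross_add_map_cross_le hσ hϖ0 hc₀ hc₁ hα hβ hint hT hTM hsq hy₁ hy₁
  have h21 : Valued.v s₂₁ ≤ Valued.v (ϖ ^ mc) := by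
    have h := v_cross_add_map_cross_le hσ hϖ0 hc₀ hc₁ hα hβ hint hT hTM hsq hy₁ hy₂
    rwa [h12, map_zero, add_zero] at h
  have hmcm : Valued.v (ϖ ^ mc) ≤ Valued.v (ϖ ^ m) := by
    rw [v_pow_eq_exp_neg hϖ, v_pow_eq_exp_neg hϖ, exp_le_exp]; omega
  -- the skew element `z′` that is `ϖ^m`-close to `s₁` (★ p859272; the design `m + d ≤ m_c + 1`)
  obtain ⟨z', hσz', hzz'⟩ := exists_skew_near_of_trace_deep hσ hfix hϖ hd ht (a := s₁) (s := -(s₁ + σ s₁)) (by rw [neg_neg])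
    (j := (mc : ℤ)) (n := (((mc + 1) / 2 : ℕ) : ℤ)) (m := m) (by rw [Valuation.map_neg, ← v_pow_eq_exp_neg hϖ]; exact htr) (by omega) (by omega)
  -- `|z′| = |s₁| = exp(−(d % 2))`
  have hvs₁ : Valued.v s₁ = exp (-((d % 2 : ℕ) : ℤ)) := by rw [hs₁, ← map_pow, v_pow_eq_exp_neg hϖ]
  have hlt : Valued.v (s₁ - z') < Valued.v s₁ := by
    have h1 : Valued.v (s₁ - z') ≤ Valued.v (ϖ ^ m) := by
      have h := hzz'
      rw [map_mul, map_inv₀] at h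
      rwa [inv_mul_le_iff₀ (zero_lt_iff.2 ((Valuation.ne_zero_iff _).2 hϖm)), mul_one] at h
    refine h1.trans_lt ?_
    rw [hvs₁, v_pow_eq_exp_neg hϖ, exp_lt_exp]
    omega
  have hvz' : Valued.v z' = exp (-((d % 2 : ℕ) : ℤ)) := by
    rw [← hvs₁, show z' = s₁ + -(s₁ - z') by ring]
    exact Valuation.map_add_eq_of_lt_left _ (by rwa [Valuation.map_neg])
  -- the class `e = z′ ∕ t₊`
  have htp0 := refSkewScalar_ne_zero hvσ hϖ hd
  have htpv := v_refSkewScalar hvσ hϖ hd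
  set e : K := z' * ((ϖ - σ ϖ) * ((ϖ * σ ϖ) ^ ((d - d % 2) / 2))⁻¹)⁻¹ with hedef
  have he : e * ((ϖ - σ ϖ) * ((ϖ * σ ϖ) ^ ((d - d % 2) / 2))⁻¹) = z' := by rw [hedef, inv_mul_cancel_right₀ htp0]
  have hσe : σ e = e := by
    have h := congrArg σ he
    rw [map_mul, map_refSkewScalar_eq_neg hσ, hσz', mul_neg, neg_inj, ← he] at h
    exact mul_right_cancel₀ htp0 h
  have he1 : Valued.v e = 1 := by
    have h := congrArg Valued.v he
    rw [map_mul, htpv, hvz'] at h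
    have hne : (exp (-((d % 2 : ℕ) : ℤ)) : ℤᵐ⁰) ≠ 0 := exp_ne_zero
    calc Valued.v e = Valued.v e * exp (-((d % 2 : ℕ) : ℤ)) * (exp (-((d % 2 : ℕ) : ℤ)))⁻¹ := by rw [mul_inv_cancel_right₀ hne]
      _ = 1 := by rw [h, mul_inv_cancel₀ hne]
  refine ⟨e, hσe, he1, ?_⟩
  -- norms are integral
  have hN : ∀ a : K, Valued.v a ≤ 1 → Valued.v (a * σ a) ≤ 1 := fun a ha => by rw [map_mul, hvσ]; exact mul_le_one' ha ha
  rw [valueSetMod_smul_xPlus]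
  ext v
  simp only [Set.mem_setOf_eq]
  constructor
  · -- (⊆) every value is `≡ N(a)·s₁ ≡ e·t₊·N(a)`
    rintro ⟨y, hy, hv⟩
    obtain ⟨a, b, c', ha, hb, hyi⟩ := hgen y hy
    refine ⟨a, ha, ?_⟩
    have hval : c 0 * (α - 1) * (y 0 * σ (y 0)) + c 1 * (β - 1) * (y 1 * σ (y 1)) = a * σ a * s₁ + σ b * a * s₂₁ + b * σ b * s₂ := by
      rw [modelValue_eq_cross_self, cross_self_expand σ c α β hyi hy₃0 hy₃1, h12, mul_zero, add_zero]
    have key : (ϖ ^ m)⁻¹ * (v - e * ((ϖ - σ ϖ) * ((ϖ * σ ϖ) ^ ((d - d % 2) / 2))⁻¹ * (a * σ a))) =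
        (ϖ ^ m)⁻¹ * (v - (c 0 * (α - 1) * (y 0 * σ (y 0)) + c 1 * (β - 1) * (y 1 * σ (y 1)))) +
          a * σ a * ((ϖ ^ m)⁻¹ * (s₁ - z')) + σ b * a * ((ϖ ^ m)⁻¹ * s₂₁) + b * σ b * ((ϖ ^ m)⁻¹ * s₂) := by
      rw [hval, ← mul_assoc e, he]
      ring
    rw [key]
    refine (Valuation.map_add _ _ _).trans (max_le ((Valuation.map_add _ _ _).trans (max_le ((Valuation.map_add _ _ _).trans (max_le hv ?_)) ?_)) ?_)
    · rw [map_mul]; exact mul_le_one' (hN a ha) hzz'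
    · rw [map_mul, map_mul, hvσ]
      refine mul_le_one' (mul_le_one' hb ha) ?_
      rw [map_mul, map_inv₀]
      exact (mul_le_mul_right (h21.trans hmcm) _).trans (le_of_eq (inv_mul_cancel₀ ((Valuation.ne_zero_iff _).2 hϖm)))
    · rw [map_mul]
      refine mul_le_one' (hN b hb) ?_
      rw [map_mul, map_inv₀]
      exact (mul_le_mul_right hs₂ _).trans (le_of_eq (inv_mul_cancel₀ ((Valuation.ne_zero_iff _).2 hϖm)))
  · -- (⊇) `e·t₊·N(a) ≡ N(a)·s₁ = S(a y₁, a y₁)`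
    rintro ⟨a, ha, hv⟩
    have haM : a • y₁ ∈ M := by
      have h := M.smul_mem (⟨a, (Valuation.mem_integer_iff _ _).2 ha⟩ : 𝒪[K]) hy₁
      exact h
    refine ⟨a • y₁, haM, ?_⟩
    have hval : c 0 * (α - 1) * ((a • y₁) 0 * σ ((a • y₁) 0)) + c 1 * (β - 1) * ((a • y₁) 1 * σ ((a • y₁) 1)) = a * σ a * s₁ := by
      simp only [Pi.smul_apply, smul_eq_mul, map_mul]
      ring
    have key : (ϖ ^ m)⁻¹ * (v - (c 0 * (α - 1) * ((a • y₁) 0 * σ ((a • y₁) 0)) + c 1 * (β - 1) * ((a • y₁) 1 * σ ((a • y₁) 1)))) =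
        (ϖ ^ m)⁻¹ * (v - e * ((ϖ - σ ϖ) * ((ϖ * σ ϖ) ^ ((d - d % 2) / 2))⁻¹ * (a * σ a))) + -(a * σ a * ((ϖ ^ m)⁻¹ * (s₁ - z'))) := by
      rw [hval, ← mul_assoc e, he]
      ring
    rw [key]
    refine (Valuation.map_add _ _ _).trans (max_le hv ?_)
    rw [Valuation.map_neg, map_mul]
    exact mul_le_one' (hN a ha) hzz'

/-- **THE SAME AT A TYPE-0 MODEL VERTEX** (the currency of ★ p859223 `exists_diagonal_model_transvFixCounts` ∕ LH4-p05 (g8)'s ★ p859798 `hmodel`, and of the normalised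
HNF model with its polarisation `D`): `diag(c)` a non-degenerate `σ`-fixed diagonal form (`c i ≠ 0`), `M` a type-0 vertex for it (self-dual, ★ `dualLatt_eq_self_of_isSelfDualLattice`
supplies the integrality), fixed by `T`, clean; (GS) ⇒ one class.
[cite: Rogawski1990, §4.9 Prop. 4.9.1 (b) p. 55] [cite: Jacobowitz1962, §4, §7] [cite: Kottwitz1986BaseChangeUnits, §1 pp. 240–241] -/
theorem exists_class_setOf_modelValue_eq_of_triple_of_isVertexLattice {σ : K →+* K} {ϖ : K} {d t : ℕ} (hσ : ∀ x, σ (σ x) = x)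
    (hvσ : ∀ a, Valued.v (σ a) = Valued.v a) (hfix : ∀ x : K, σ x = x → x ≠ 0 → ∃ n : ℤ, Valued.v x = exp (2 * n))
    (hϖ : Valued.v ϖ = exp (-1 : ℤ)) (hd : Valued.v (ϖ - σ ϖ) = Valued.v ϖ ^ d) (ht : Valued.v (2 : K) = Valued.v ϖ ^ t)
    {c : Fin 3 → K} (hc : ∀ i, c i ≠ 0) (hc₀ : σ (c 0) = c 0) (hc₁ : σ (c 1) = c 1) {α β : K} (hα : α * σ α = 1) (hβ : β * σ β = 1)
    {M : Submodule 𝒪[K] (Fin 3 → K)} (hM : IsVertexLattice σ ϖ (Matrix.diagonal c) 0 M)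
    {T : GL (Fin 3) K} (hT : (T : Matrix (Fin 3) (Fin 3) K) = Matrix.diagonal ![α, β, 1]) (hTM : mapGL T M = M)
    {m mc : ℕ} (h1d : 1 ≤ d) (hm : d % 2 < m) (hmc : m + d ≤ mc + 1)
    (hsq : LatticeInLevel ϖ mc (Matrix.diagonal ![(α - 1) * (α - 1), (β - 1) * (β - 1), 0]) M)
    {y₁ y₂ y₃ : Fin 3 → K} (hy₁ : y₁ ∈ M) (hy₂ : y₂ ∈ M) (hy₃0 : y₃ 0 = 0) (hy₃1 : y₃ 1 = 0)
    (hgen : ∀ y ∈ M, ∃ a b c' : K, Valued.v a ≤ 1 ∧ Valued.v b ≤ 1 ∧ ∀ i, y i = a * y₁ i + b * y₂ i + c' * y₃ i)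
    (h12 : c 0 * σ (y₁ 0) * ((α - 1) * y₂ 0) + c 1 * σ (y₁ 1) * ((β - 1) * y₂ 1) = 0)
    (hs₁ : Valued.v (c 0 * σ (y₁ 0) * ((α - 1) * y₁ 0) + c 1 * σ (y₁ 1) * ((β - 1) * y₁ 1)) = Valued.v ϖ ^ (d % 2))
    (hs₂ : Valued.v (c 0 * σ (y₂ 0) * ((α - 1) * y₂ 0) + c 1 * σ (y₂ 1) * ((β - 1) * y₂ 1)) ≤ Valued.v (ϖ ^ m)) :
    ∃ e : K, σ e = e ∧ Valued.v e = 1 ∧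
      {v | ∃ y ∈ M, Valued.v ((ϖ ^ m)⁻¹ * (v - (c 0 * (α - 1) * (y 0 * σ (y 0)) + c 1 * (β - 1) * (y 1 * σ (y 1))))) ≤ 1} =
        valueSetMod σ ϖ m (e • xPlus σ ϖ d) := by
  have hdet : IsUnit (Matrix.diagonal c).det := by
    rw [Matrix.det_diagonal, isUnit_iff_ne_zero]
    exact Finset.prod_ne_zero_iff.2 fun i _ => hc i
  have hdual : dualLatt σ (Matrix.diagonal c) M = M := dualLatt_eq_self_of_isSelfDualLattice hvσ hdet hM
  have hint : ∀ y ∈ M, ∀ y' ∈ M, Valued.v (pairing σ (Matrix.diagonal c) y y') ≤ 1 := fun y hy y' hy' => by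
    have h := hy'
    rw [← hdual, mem_dualLatt] at h
    exact h y hy
  exact exists_class_setOf_modelValue_eq_of_triple hσ hvσ hfix hϖ hd ht hc₀ hc₁ hα hβ hint hT hTM h1d hm hmc hsq hy₁ hy₂ hy₃0 hy₃1 hgen h12 hs₁ hs₂

end Summit.HodgeConjecture.HodgeConjecture.Cruxes.H413.F0P3cDyRamCleanShellOneClass

end
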